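import Summits.CriticalPhenomena.SAWScalingLimit.Theses.SAWRenewalTightness
import Literature.Probability.RandomPlanarGeometry.SAWBridgeRadius

/-!
# Negative knowledge on crux `TubeLowerBound` (stmt-CriticalPhenomena-4730, route `SAWRenewalTightness` r4), part 1: normalisation, slack, liminf form, two-point floor

Refuter `cdisprove` (standing adversary); the indexed work file is
`Summits/CriticalPhenomena/SAWScalingLimit/Cruxes/TubeLowerBound/Disproof.lean`.  All statements here
are PROVED (no named facts):

* `constraints` — any witness `(C, c)` of the crux has `0 ≤ C`, `c ≤ 1` (`u = v`: tube mass `≡ 1`);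
* `exponent_eq_zero_of_withoutOneLe`, `withoutOneLe_iff_uniform` — dropping `1 ≤ ℓ` collapses the
  crux to the uniform floor `C = 0`;
* `not_withoutSlack` — the additive `+ 2` in the tube radius is load-bearing (diagonal neighbours);
* `not_allN` — the `∃ N` (liminf) form cannot be strengthened to `∀ N`;
* `twoPoint_floor` — the crux implies a pointwise polynomial floor for the partial sums of the
  critical two-point function `G_{x_c}(0,v)` (not in print: Madras–Slade 1993 §8.1 p. 259).

Part 2 (`TubeLowerBoundFixedWidth.lean`): `not_withoutDist` (the aspect-ratio coupling is
load-bearing, via Kesten's pattern theorem) and `not_atFugacity_of_lt` (criticality is load-bearing).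
-/

noncomputable section

namespace Summit.CriticalPhenomena.SAWScalingLimit.Theorems.TubeLowerBound.Negative

open Literature.Probability.LatticeModels Literature.Probability.RandomPlanarGeometry
open Literature.Probability.RandomPlanarGeometry.SAW
open Summit.CriticalPhenomena.SAWScalingLimit.Theses.SAWRenewalTightness (TubeLowerBound)
open Filter Topology
open scoped BigOperators

/-! ### The tube mass -/

open Classical in
/-- `tubeMass x u v r N = Σ_{n ≤ N} Σ_{ω : n-step SAW u → v, all vertices within r of [u,v]} x^n`:
the partial sum up to length `N` of the `x`-mass of self-avoiding walks from `u` to `v` confined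
to the closed `r`-neighbourhood of the segment `[u, v]` (the double sum of the crux, with the
fugacity and the tube radius made parameters). [folklore] -/
def tubeMass (x : ℝ) (u v : Site 2) (r : ℝ) (N : ℕ) : ℝ :=
  ∑ n ∈ Finset.range (N + 1), ∑ _ω ∈ (Zd.sawFun 2 n (v - u)).filter
    (fun ω => ∀ i ≤ n, Metric.infDist (Site.toComplex (u + ω i))
      (segment ℝ (Site.toComplex u) (Site.toComplex v)) ≤ r), x ^ n

/-- The crux, restated through `tubeMass` (definitionally). [folklore] -/
theorem tubeLowerBound_iff :
    TubeLowerBound ↔ ∃ C c : ℝ, 0 < c ∧ ∀ (u v : Site 2) (ℓ : ℝ), 1 ≤ ℓ →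
      dist (Site.toComplex u) (Site.toComplex v) ≤ ℓ →
        ∃ N : ℕ, c * ℓ ^ (-C) ≤ tubeMass criticalFugacity u v (ℓ / 10 + 2) N :=
  Iff.rfl

/-! ### Elementary facts: walks from a point to itself -/

/-- No self-avoiding walk of positive length returns to its starting point. [folklore] -/
theorem sawFun_self_eq_empty {n : ℕ} (hn : n ≠ 0) : Zd.sawFun 2 n (0 : Site 2) = ∅ := by
  ext ω
  simp only [Finset.notMem_empty, iff_false]
  intro h
  obtain ⟨h0, hend, -, hinj⟩ := Zd.mem_sawFun.1 h
  have := hinj (show (0 : ℕ) ∈ {i | i ≤ n} from Nat.zero_le n)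
    (show n ∈ {i | i ≤ n} from le_refl n) (by rw [h0, hend n le_rfl])
  exact hn this.symm

/-- The only `0`-step walk from `0` to `0` is the constant one. [folklore] -/
theorem sawFun_zero_zero : Zd.sawFun 2 0 (0 : Site 2) = {fun _ => 0} := by
  ext ω
  rw [Zd.mem_sawFun, Finset.mem_singleton]
  constructor
  · rintro ⟨-, hend, -, -⟩
    funext i
    exact hend i (Nat.zero_le i)
  · rintro rfl
    refine ⟨rfl, fun i _ => rfl, fun i hi => absurd hi (Nat.not_lt_zero i), ?_⟩
    intro i hi j hj _
    simp only [Set.mem_setOf_eq, Nat.le_zero] at hi hj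
    rw [hi, hj]

/-- There is no `0`-step walk from `0` to `v ≠ 0`. [folklore] -/
theorem sawFun_zero_eq_empty {v : Site 2} (hv : v ≠ 0) : Zd.sawFun 2 0 v = ∅ := by
  ext ω
  simp only [Finset.notMem_empty, iff_false]
  intro h
  obtain ⟨h0, hend, -, -⟩ := Zd.mem_sawFun.1 h
  exact hv ((hend 0 le_rfl).symm.trans h0)

/-- An `n`-step walk from `0` to `v` has `n ≥ |v j|` for each coordinate `j`. [folklore] -/
theorem le_of_mem_sawFun {n : ℕ} {v : Site 2} {ω : ℕ → Site 2} (h : ω ∈ Zd.sawFun 2 n v)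
    (j : Fin 2) : |v j| ≤ n := by
  obtain ⟨h0, hend, hadj, -⟩ := Zd.mem_sawFun.1 h
  have := Zd.abs_apply_le_of_adj h0 hadj n le_rfl j
  rwa [hend n le_rfl] at this

/-- **`u = v`: the tube mass is identically `1`** (only the trivial walk; every partial sum).
[folklore] -/
theorem tubeMass_self (x : ℝ) (u : Site 2) {r : ℝ} (hr : 0 ≤ r) (N : ℕ) :
    tubeMass x u u r N = 1 := by
  classical
  unfold tubeMass
  rw [Finset.sum_eq_single_of_mem 0 (Finset.mem_range.2 (Nat.succ_pos N))]
  · rw [sub_self, sawFun_zero_zero, Finset.filter_singleton, if_pos, Finset.sum_singleton, pow_zero]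
    intro i _
    rw [add_zero]
    rw [Metric.infDist_zero_of_mem (left_mem_segment ℝ _ _)]
    exact hr
  · intro n _ hn
    rw [sub_self, sawFun_self_eq_empty hn, Finset.filter_empty, Finset.sum_empty]

/-- The tube mass is nonnegative for a nonnegative fugacity. [folklore] -/
theorem tubeMass_nonneg {x : ℝ} (hx : 0 ≤ x) (u v : Site 2) (r : ℝ) (N : ℕ) :
    0 ≤ tubeMass x u v r N :=
  Finset.sum_nonneg fun n _ => Finset.sum_nonneg fun _ _ => pow_nonneg hx n

/-! ### (a) Load-bearing analysis -/

/-- **Normalisation constraints.** Any witness `(C, c)` of the crux has `0 ≤ C` and `c ≤ 1`: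
at `u = v` the tube mass is `1` for every `ℓ ≥ 1`, so `c ℓ^{-C} ≤ 1` on `[1, ∞)`.  In particular
the exponent `-C` can never be positive ("the bound cannot grow with `ℓ`"). [folklore] -/
theorem constraints {C c : ℝ} (hc : 0 < c)
    (h : ∀ (u v : Site 2) (ℓ : ℝ), 1 ≤ ℓ → dist (Site.toComplex u) (Site.toComplex v) ≤ ℓ →
      ∃ N : ℕ, c * ℓ ^ (-C) ≤ tubeMass criticalFugacity u v (ℓ / 10 + 2) N) :
    0 ≤ C ∧ c ≤ 1 := by
  have key : ∀ ℓ : ℝ, 1 ≤ ℓ → c * ℓ ^ (-C) ≤ 1 := by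
    intro ℓ hℓ
    obtain ⟨N, hN⟩ := h 0 0 ℓ hℓ (by rw [dist_self]; linarith)
    rwa [tubeMass_self _ _ (by linarith) N] at hN
  constructor
  · by_contra hC
    push Not at hC
    have ht : Tendsto (fun ℓ : ℝ => c * ℓ ^ (-C)) atTop atTop :=
      Tendsto.const_mul_atTop hc (tendsto_rpow_atTop (by linarith))
    obtain ⟨ℓ, hℓ1, hℓ2⟩ := ((ht.eventually_gt_atTop 1).and (eventually_ge_atTop 1)).exists
    exact absurd (key ℓ hℓ2) (not_le.2 hℓ1)
  · simpa using key 1 le_rfl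

/-- **Dropping `1 ≤ ℓ` forces `C = 0`.** With only `0 < ℓ`, the instance `u = v`, `ℓ = (c/2)^{1/C}`
kills every `C > 0` (and `constraints` kills `C < 0`), so the weakened statement is equivalent to
the UNIFORM floor `tubeMass ≥ c` — conjecturally false (`G_{x_c}(0,v) → 0` like `|v|^{-5/24}`),
but no decay of the critical two-point function on `ℤ²` is proved, so this is as far as the
refutation goes: the hypothesis `1 ≤ ℓ` is what makes a positive exponent admissible. [folklore] -/
theorem exponent_eq_zero_of_withoutOneLe {C c : ℝ} (hc : 0 < c)
    (h : ∀ (u v : Site 2) (ℓ : ℝ), 0 < ℓ → dist (Site.toComplex u) (Site.toComplex v) ≤ ℓ →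
      ∃ N : ℕ, c * ℓ ^ (-C) ≤ tubeMass criticalFugacity u v (ℓ / 10 + 2) N) :
    C = 0 := by
  have hC0 : 0 ≤ C := (constraints hc fun u v ℓ hℓ hd => h u v ℓ (by linarith) hd).1
  have key : ∀ ℓ : ℝ, 0 < ℓ → c * ℓ ^ (-C) ≤ 1 := by
    intro ℓ hℓ
    obtain ⟨N, hN⟩ := h 0 0 ℓ hℓ (by rw [dist_self]; linarith)
    rwa [tubeMass_self _ _ (by linarith) N] at hN
  by_contra hC
  have hCpos : 0 < C := lt_of_le_of_ne hC0 (Ne.symm hC)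
  have hb : 0 < c / 2 := by linarith
  have := key ((c / 2) ^ (1 / C)) (Real.rpow_pos_of_pos hb _)
  rw [← Real.rpow_mul hb.le, show 1 / C * -C = -1 by field_simp, Real.rpow_neg_one] at this
  rw [show c * (c / 2)⁻¹ = 2 by field_simp] at this
  linarith

/-- The crux with `1 ≤ ℓ` weakened to `0 < ℓ` collapses to the uniform floor (the `C = 0`
strengthening of the crux). [folklore] -/
theorem withoutOneLe_iff_uniform :
    (∃ C c : ℝ, 0 < c ∧ ∀ (u v : Site 2) (ℓ : ℝ), 0 < ℓ →
      dist (Site.toComplex u) (Site.toComplex v) ≤ ℓ →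
        ∃ N : ℕ, c * ℓ ^ (-C) ≤ tubeMass criticalFugacity u v (ℓ / 10 + 2) N) ↔
    ∃ c : ℝ, 0 < c ∧ ∀ (u v : Site 2) (ℓ : ℝ), 0 < ℓ →
      dist (Site.toComplex u) (Site.toComplex v) ≤ ℓ →
        ∃ N : ℕ, c ≤ tubeMass criticalFugacity u v (ℓ / 10 + 2) N := by
  constructor
  · rintro ⟨C, c, hc, h⟩
    have hC := exponent_eq_zero_of_withoutOneLe hc h
    subst hC
    refine ⟨c, hc, fun u v ℓ hℓ hd => ?_⟩
    obtain ⟨N, hN⟩ := h u v ℓ hℓ hd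
    exact ⟨N, by simpa using hN⟩
  · rintro ⟨c, hc, h⟩
    refine ⟨0, c, hc, fun u v ℓ hℓ hd => ?_⟩
    obtain ⟨N, hN⟩ := h u v ℓ hℓ hd
    exact ⟨N, by simpa using hN⟩

/-- **The additive slack is load-bearing**: without `+ 2`, the diagonal neighbours `u = 0`,
`v = (1, 1)` at `ℓ = 3/2` have an EMPTY tube (every first step leaves the `3/20`-neighbourhood of
the diagonal segment: a lattice neighbour `p` of `0` has `|p₁ - p₂| = 1`, hence distance
`≥ 1/√2` from the diagonal), so the mass is `0 < c (3/2)^{-C}`. [folklore] -/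
theorem not_withoutSlack : ¬ (∃ C c : ℝ, 0 < c ∧ ∀ (u v : Site 2) (ℓ : ℝ), 1 ≤ ℓ →
    dist (Site.toComplex u) (Site.toComplex v) ≤ ℓ →
      ∃ N : ℕ, c * ℓ ^ (-C) ≤ tubeMass criticalFugacity u v (ℓ / 10) N) := by
  classical
  rintro ⟨C, c, hc, h⟩
  have toComplex_zero : Site.toComplex (0 : Site 2) = 0 := by
    apply Complex.ext <;> simp [Site.toComplex]
  have hv : Site.toComplex (![1, 1] : Site 2) = ⟨1, 1⟩ := by
    apply Complex.ext <;> simp [Site.toComplex]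
  have hdist : dist (Site.toComplex (0 : Site 2)) (Site.toComplex (![1, 1] : Site 2)) ≤ 3 / 2 := by
    rw [toComplex_zero, hv, Complex.dist_eq, zero_sub, norm_neg]
    have h2 : ‖(⟨1, 1⟩ : ℂ)‖ ^ 2 = 2 := by
      rw [Complex.sq_norm, Complex.normSq_apply]; norm_num
    nlinarith [norm_nonneg (⟨1, 1⟩ : ℂ)]
  obtain ⟨N, hN⟩ := h 0 ![1, 1] (3 / 2) (by norm_num) hdist
  have hzero : tubeMass criticalFugacity 0 ![1, 1] (3 / 2 / 10) N = 0 := by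
    unfold tubeMass
    refine Finset.sum_eq_zero fun n _ => Finset.sum_eq_zero fun ω hω => ?_
    exfalso
    rw [Finset.mem_filter, sub_zero] at hω
    obtain ⟨hω, htube⟩ := hω
    obtain ⟨h0, hend, hadj, -⟩ := Zd.mem_sawFun.1 hω
    rcases Nat.eq_zero_or_pos n with rfl | hn1
    · have := congrFun ((hend 0 le_rfl).symm.trans h0) 0
      simp at this
    · have had := hadj 0 hn1
      rw [h0] at had
      have ht := htube 1 hn1
      rw [zero_add] at ht
      have hne : (segment ℝ (Site.toComplex (0 : Site 2)) (Site.toComplex (![1, 1] : Site 2))).Nonempty :=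
        ⟨_, left_mem_segment ℝ _ _⟩
      obtain ⟨y, hy, hdy⟩ := (Metric.infDist_lt_iff hne).1
        (lt_of_le_of_lt ht (by norm_num : (3 : ℝ) / 2 / 10 < 1 / 2))
      rw [toComplex_zero, hv] at hy
      obtain ⟨a, b, -, -, -, rfl⟩ := hy
      have hdiff : ((Site.toComplex (ω 1)).re - (Site.toComplex (ω 1)).im) ^ 2 = 1 := by
        obtain ⟨i, hi | hi⟩ := (Zd.zdGraph_adj_iff_sub _ _).1 had
        · rw [sub_zero] at hi
          rw [hi]
          fin_cases i <;> simp [Site.toComplex]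
        · rw [zero_sub, neg_eq_iff_eq_neg] at hi
          rw [hi]
          fin_cases i <;> simp [Site.toComplex]
      have hns : (1 : ℝ) / 2 ≤ Complex.normSq (Site.toComplex (ω 1) - (a • (0 : ℂ) + b • (⟨1, 1⟩ : ℂ))) := by
        rw [Complex.normSq_apply]
        simp only [Complex.sub_re, Complex.sub_im, smul_zero,
          zero_add, Complex.smul_re, Complex.smul_im, smul_eq_mul, mul_one]
        nlinarith [hdiff, sq_nonneg ((Site.toComplex (ω 1)).re - b + ((Site.toComplex (ω 1)).im - b))]
      have hsq : dist (Site.toComplex (ω 1)) (a • (0 : ℂ) + b • ⟨1, 1⟩) ^ 2 < 1 / 4 := by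
        nlinarith [dist_nonneg (x := Site.toComplex (ω 1)) (y := a • (0 : ℂ) + b • ⟨1, 1⟩)]
      rw [Complex.dist_eq, Complex.sq_norm] at hsq
      linarith
  rw [hzero] at hN
  have : 0 < c * (3 / 2 : ℝ) ^ (-C) := mul_pos hc (Real.rpow_pos_of_pos (by norm_num) _)
  linarith

/-- **The liminf form `∃ N` is essential**: with `∀ N` the partial sum `N = 0` vanishes for
`u ≠ v` (no `0`-step walk), e.g. `u = 0`, `v = (1, 0)`, `ℓ = 1`.  (Typing remark only: for a
series of nonnegative terms `∃ N` is the right monotone-robust floor.) [folklore] -/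
theorem not_allN : ¬ (∃ C c : ℝ, 0 < c ∧ ∀ (u v : Site 2) (ℓ : ℝ), 1 ≤ ℓ →
    dist (Site.toComplex u) (Site.toComplex v) ≤ ℓ →
      ∀ N : ℕ, c * ℓ ^ (-C) ≤ tubeMass criticalFugacity u v (ℓ / 10 + 2) N) := by
  classical
  rintro ⟨C, c, hc, h⟩
  have toComplex_zero : Site.toComplex (0 : Site 2) = 0 := by
    apply Complex.ext <;> simp [Site.toComplex]
  have hv : Site.toComplex (![1, 0] : Site 2) = 1 := by
    apply Complex.ext <;> simp [Site.toComplex]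
  have hv0 : (![1, 0] : Site 2) ≠ 0 := fun h => by simpa using congrFun h 0
  have := h 0 ![1, 0] 1 le_rfl (by rw [toComplex_zero, hv]; simp) 0
  have hzero : tubeMass criticalFugacity 0 ![1, 0] (1 / 10 + 2) 0 = 0 := by
    unfold tubeMass
    rw [Finset.sum_range_one, sub_zero, sawFun_zero_eq_empty hv0, Finset.filter_empty,
      Finset.sum_empty]
  rw [hzero, Real.one_rpow, mul_one] at this
  linarith

/-! ### (b) What the crux entails: a pointwise polynomial floor for the critical two-point function -/

/-- A nonzero lattice point is at distance `≥ 1` from the origin. [folklore] -/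
theorem one_le_dist_of_ne_zero {v : Site 2} (hv : v ≠ 0) :
    1 ≤ dist (Site.toComplex (0 : Site 2)) (Site.toComplex v) := by
  have toComplex_zero : Site.toComplex (0 : Site 2) = 0 := by
    apply Complex.ext <;> simp [Site.toComplex]
  rw [toComplex_zero, Complex.dist_eq, zero_sub, norm_neg]
  have : v 0 ≠ 0 ∨ v 1 ≠ 0 := by
    by_contra hcon
    push Not at hcon
    apply hv
    funext j
    fin_cases j
    · exact hcon.1
    · exact hcon.2
  rcases this with h0 | h1
  · calc (1 : ℝ) ≤ |((v 0 : ℤ) : ℝ)| := by exact_mod_cast Int.one_le_abs h0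
      _ = |(Site.toComplex v).re| := by simp [Site.toComplex]
      _ ≤ ‖Site.toComplex v‖ := Complex.abs_re_le_norm _
  · calc (1 : ℝ) ≤ |((v 1 : ℤ) : ℝ)| := by exact_mod_cast Int.one_le_abs h1
      _ = |(Site.toComplex v).im| := by simp [Site.toComplex]
      _ ≤ ‖Site.toComplex v‖ := Complex.abs_im_le_norm _

/-- **The crux contains Madras–Slade's open problem.** `TubeLowerBound` implies a pointwise
polynomial lower bound `Σ_{n ≤ N} c_n(v) x_c^n ≥ c |v|^{-C}` for the (partial sums of the)
critical two-point function `G_{x_c}(0, v)`, for every `v ≠ 0` — drop the tube constraint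
(terms are nonnegative) and take `ℓ = |v|`.  Madras–Slade 1993, §8.1 p. 259: "we are not aware of
any rigorous lower bound of the form `q_N ≥ const·N^{-p} μ^N`"; no pointwise polynomial floor
for `G_{x_c}` on `ℤ²` is in print.  [cite: MadrasSlade1993, §8.1 p. 259] -/
theorem twoPoint_floor (h : TubeLowerBound) :
    ∃ C c : ℝ, 0 < c ∧ ∀ v : Site 2, v ≠ 0 →
      ∃ N : ℕ, c * (dist (Site.toComplex (0 : Site 2)) (Site.toComplex v)) ^ (-C) ≤
        ∑ n ∈ Finset.range (N + 1), (Zd.countAt 2 n v : ℝ) * criticalFugacity ^ n := by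
  classical
  obtain ⟨C, c, hc, h⟩ := h
  refine ⟨C, c, hc, fun v hv => ?_⟩
  obtain ⟨N, hN⟩ := h 0 v _ (one_le_dist_of_ne_zero hv) le_rfl
  refine ⟨N, hN.trans (Finset.sum_le_sum fun n _ => ?_)⟩
  rw [sub_zero]
  calc ∑ _ω ∈ (Zd.sawFun 2 n v).filter (fun ω => ∀ i ≤ n,
          Metric.infDist (Site.toComplex (0 + ω i))
            (segment ℝ (Site.toComplex 0) (Site.toComplex v)) ≤
              dist (Site.toComplex (0 : Site 2)) (Site.toComplex v) / 10 + 2),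
          criticalFugacity ^ n
        ≤ ∑ _ω ∈ Zd.sawFun 2 n v, criticalFugacity ^ n :=
          Finset.sum_le_sum_of_subset_of_nonneg (Finset.filter_subset _ _)
            (fun _ _ _ => pow_nonneg criticalFugacity_pos.le _)
    _ = (Zd.countAt 2 n v : ℝ) * criticalFugacity ^ n := by
          rw [Finset.sum_const, nsmul_eq_mul, Zd.card_sawFun]

end Summit.CriticalPhenomena.SAWScalingLimit.Theorems.TubeLowerBound.Negative
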